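import Literature.AlgebraicGeometry.Motives.SmoothProperWittModel
import HarnessLib

/-!
# Smooth proper `W(κ)`-models by base change along an arbitrary ring map `T → W(κ)`

Topic `Literature/AlgebraicGeometry/Motives`; companion of `SmoothProperWittModel`. The construction
`𝒴 = Y ⊗_{T, χ} W(κ)` of `Motives.exists_isSmoothProperModel_wittVector`, isolated for an ARBITRARY
ring map `χ : T → W(κ)` (a `W(κ)`-point of `Spec T`, not necessarily dominant) and an embedding
`ι : Frac W(κ) → ℂ`: whenever the complex fibre `Y ⊗_{T, ι∘χ} ℂ` is a smooth projective
geometrically irreducible variety of dimension `n`, `𝒴` is a smooth proper (indeed projective)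
model of relative dimension `n` in the sense of `WittScheme.IsSmoothProperModel`, with
`𝒴_K ⊗_ι ℂ ≅` that fibre. This is the form used for several `W(κ)`-points of one base `Spec T`
with a common reduction — the `p`-adic residue discs of Maulik–Poonen 2012, §4 — where the two models
then have the same special fibre.

* `isSmoothProperModel_baseChange_wittVector`.

## References

* [MaulikPoonen2012] D. Maulik, B. Poonen, Néron–Severi groups under specialization, Duke Math.
  J. 161 (2012), §4.
-/

noncomputable section

open CategoryTheory CategoryTheory.Limits AlgebraicGeometry TopologicalSpace MvPolynomial Cardinal
open Literature.AlgebraicGeometry.HodgeTheory.SpreadingOutQbar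
open Literature.RingTheory.CompleteLocalRings
open scoped Isocrystal

namespace Literature.AlgebraicGeometry.Motives

/-- **Base change of a smooth projective `T`-scheme along ANY ring map `χ : T → W(κ)` is a smooth
proper `W(κ)`-model of the corresponding complex fibre** — the construction of
`exists_isSmoothProperModel_wittVector`, stated for an arbitrary `χ` (not necessarily injective)
and an embedding `ι : Frac W(κ) → ℂ`: if the complex fibre `X = Y ⊗_{T, ι ∘ χ} ℂ` of the smooth
projective `Y ↪ ℙᴹ_T` is a smooth projective (geometrically irreducible) variety of dimension `n`,
then `𝒴 = Y ⊗_χ W(κ)` is a smooth proper model of relative dimension `n`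
(`WittScheme.IsSmoothProperModel`, its special fibre geometrically irreducible by Zariski
connectedness over the normal base `W(κ)`), closed in `ℙᴹ_{W(κ)}`, with `𝒴_K ⊗_ι ℂ ≅ X`. This is the
form needed for SEVERAL `W`-points of one base (residue discs, Maulik–Poonen 2012 §4).
[cite: MaulikPoonen2012, §4] -/
theorem isSmoothProperModel_baseChange_wittVector {p : ℕ} [Fact p.Prime] {κ : Type} [Field κ]
    [CharP κ p] [PerfectRing κ p] {T : Type} [CommRing T] {n M : ℕ} {Y : Scheme.{0}}
    {g : Y ⟶ Spec (.of T)}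
    (emb : letI := MvPolynomial.gradedAlgebra (σ := Fin (M + 1)) (R := T)
      Y ⟶ Proj (homogeneousSubmodule (Fin (M + 1)) T))
    (hemb : IsClosedImmersion emb)
    (hembg : letI := MvPolynomial.gradedAlgebra (σ := Fin (M + 1)) (R := T)
      emb ≫ ProjBaseChangeRing.projToSpec (Fin (M + 1)) T = g)
    (hgP : IsProper g) (hgS : SmoothOfRelativeDimension n g)
    (χ : T →+* WittVector p κ) (ι : K(p, κ) →+* ℂ) {X : SchemeOver ℂ} (hX : IsSmoothProjective n X)
    (π : X.left ⟶ Y)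
    (HX : IsPullback π X.hom g (Spec.map (CommRingCat.ofHom
      ((ι.comp (algebraMap (WittVector p κ) K(p, κ))).comp χ)))) :
    letI := MvPolynomial.gradedAlgebra (σ := Fin (M + 1)) (R := WittVector p κ)
    ∃ (embW : pullback g (Spec.map (CommRingCat.ofHom χ)) ⟶
        Proj (homogeneousSubmodule (Fin (M + 1)) (WittVector p κ))),
      IsClosedImmersion embW ∧
      embW ≫ ProjBaseChangeRing.projToSpec (Fin (M + 1)) (WittVector p κ) =
        pullback.snd g (Spec.map (CommRingCat.ofHom χ)) ∧
      WittScheme.IsSmoothProperModel n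
        (Over.mk (pullback.snd g (Spec.map (CommRingCat.ofHom χ))) : SchemeOver (WittVector p κ)) ∧
      Nonempty ((baseChangeHom ι).obj (WittScheme.genericFibre
        (Over.mk (pullback.snd g (Spec.map (CommRingCat.ofHom χ))) : SchemeOver (WittVector p κ))) ≅ X) := by
  classical
  letI := MvPolynomial.gradedAlgebra (σ := Fin (M + 1)) (R := T)
  haveI := hemb
  haveI := hgP
  haveI := hgS
  set W := WittVector p κ with hW
  haveI : CharZero W := charZero_wittVector p κ
  -- C. the model `𝒴 = Y ×_T Spec W`
  set jφ : Spec (.of W) ⟶ Spec (.of T) := Spec.map (CommRingCat.ofHom χ) with hjφ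
  let 𝒴 : SchemeOver W := Over.mk (pullback.snd g jφ)
  have h𝒴hom : 𝒴.hom = pullback.snd g jφ := rfl
  let a : 𝒴.left ⟶ Y := pullback.fst g jφ
  have sqW : IsPullback a 𝒴.hom g jφ := IsPullback.of_hasPullback g jφ
  haveI := smoothOfRelativeDimension_isStableUnderBaseChange (n := n)
  haveI h𝒴S : SmoothOfRelativeDimension n 𝒴.hom :=
    MorphismProperty.pullback_snd (P := @SmoothOfRelativeDimension n) g jφ hgS
  haveI h𝒴P : IsProper 𝒴.hom := MorphismProperty.pullback_snd (P := @IsProper) g jφ hgP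
  -- D. the generic fibre `𝒴_K` and its base change to `ℂ`, which is `X`
  set jK : Spec (.of K(p, κ)) ⟶ Spec (.of W) :=
    Spec.map (CommRingCat.ofHom (algebraMap W K(p, κ))) with hjK
  have hgen_left : (WittScheme.genericFibre 𝒴).left = pullback 𝒴.hom jK := rfl
  have hgen_hom : (WittScheme.genericFibre 𝒴).hom = pullback.snd 𝒴.hom jK := rfl
  let gen : (WittScheme.genericFibre 𝒴).left ⟶ 𝒴.left := pullback.fst 𝒴.hom jK
  have sqK : IsPullback gen (WittScheme.genericFibre 𝒴).hom 𝒴.hom jK :=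
    IsPullback.of_hasPullback 𝒴.hom jK
  have big : IsPullback (gen ≫ a) (WittScheme.genericFibre 𝒴).hom g (jK ≫ jφ) :=
    sqK.paste_horiz sqW
  letI : Algebra K(p, κ) ℂ := ι.toAlgebra
  set jι : Spec (.of ℂ) ⟶ Spec (.of K(p, κ)) :=
    Spec.map (CommRingCat.ofHom (algebraMap K(p, κ) ℂ)) with hjι
  have hψfac : Spec.map (CommRingCat.ofHom ((ι.comp (algebraMap W K(p, κ))).comp χ)) =
      jι ≫ (jK ≫ jφ) := by
    rw [hjι, hjK, hjφ, ← Spec.map_comp, ← Spec.map_comp, ← CommRingCat.ofHom_comp,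
      ← CommRingCat.ofHom_comp]
  have HX' : IsPullback π X.hom g (jι ≫ (jK ≫ jφ)) := hψfac ▸ HX
  let ℓ : X.left ⟶ (WittScheme.genericFibre 𝒴).left :=
    big.lift π (X.hom ≫ jι) (by rw [Category.assoc]; exact HX'.w)
  have hℓ₁ : ℓ ≫ (gen ≫ a) = π := big.lift_fst _ _ _
  have hℓ₂ : ℓ ≫ (WittScheme.genericFibre 𝒴).hom = X.hom ≫ jι := big.lift_snd _ _ _
  have SqX : IsPullback ℓ X.hom (WittScheme.genericFibre 𝒴).hom jι :=
    IsPullback.of_right (by rw [hℓ₁]; exact HX') hℓ₂ big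
  -- E. geometric irreducibility of all fibres of `𝒴 → Spec W` (Zariski connectedness, Tag 0AY8)
  haveI : GeometricallyIrreducible X.hom := hX.geometricallyIrreducible
  haveI : SmoothOfRelativeDimension n (WittScheme.genericFibre 𝒴).hom :=
    MorphismProperty.pullback_snd (P := @SmoothOfRelativeDimension n) 𝒴.hom jK h𝒴S
  haveI : Smooth (WittScheme.genericFibre 𝒴).hom :=
    SmoothOfRelativeDimension.smooth n (WittScheme.genericFibre 𝒴).hom
  haveI : GeometricallyReduced (WittScheme.genericFibre 𝒴).hom :=
    geometricallyReduced_of_smooth (WittScheme.genericFibre 𝒴).hom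
  haveI hKint : GeometricallyIntegral (WittScheme.genericFibre 𝒴).hom :=
    geometricallyIntegral_of_isPullback SqX
  haveI : GeometricallyIntegral (𝒴.hom.fiberToSpecResidueField (genericPoint (Spec (.of W)))) :=
    of_isPullback_genericFibre (R := W) (K := K(p, κ)) @GeometricallyIntegral 𝒴.hom sqK hKint
  have h𝒴irr : GeometricallyIrreducible 𝒴.hom := geometricallyIrreducible_of_genericFibre 𝒴.hom n
  -- F. the special fibre
  letI : Algebra T κ := (WittVector.constantCoeff.comp χ).toAlgebra
  set jκ : Spec (.of κ) ⟶ Spec (.of W) :=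
    Spec.map (CommRingCat.ofHom (WittVector.constantCoeff : W →+* κ)) with hjκ
  have hsp_hom : (WittScheme.specialFibre 𝒴).hom = pullback.snd 𝒴.hom jκ := rfl
  have sqκ : IsPullback (pullback.fst 𝒴.hom jκ) (WittScheme.specialFibre 𝒴).hom 𝒴.hom jκ :=
    IsPullback.of_hasPullback 𝒴.hom jκ
  have bigκ : IsPullback (pullback.fst 𝒴.hom jκ ≫ a) (WittScheme.specialFibre 𝒴).hom g
      (Spec.map (CommRingCat.ofHom (algebraMap T κ))) := by
    have h : Spec.map (CommRingCat.ofHom (algebraMap T κ)) = jκ ≫ jφ := by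
      rw [hjκ, hjφ, ← Spec.map_comp, ← CommRingCat.ofHom_comp]
    rw [h]; exact sqκ.paste_horiz sqW
  have hsp : IsSmoothProjective n (WittScheme.specialFibre 𝒴) :=
    { smoothOfRelativeDimension :=
        MorphismProperty.pullback_snd (P := @SmoothOfRelativeDimension n) 𝒴.hom jκ h𝒴S
      isProjectiveOver := isProjectiveOver_of_isPullback_proj emb hembg _ _ bigκ
      geometricallyIrreducible := by
        rw [hsp_hom]
        exact MorphismProperty.pullback_snd (P := @GeometricallyIrreducible) 𝒴.hom jκ h𝒴irr }
  -- G. the generic fibre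
  letI : Algebra T K(p, κ) := ((algebraMap W K(p, κ)).comp χ).toAlgebra
  have bigK : IsPullback (gen ≫ a) (WittScheme.genericFibre 𝒴).hom g
      (Spec.map (CommRingCat.ofHom (algebraMap T K(p, κ)))) := by
    have h : Spec.map (CommRingCat.ofHom (algebraMap T K(p, κ))) = jK ≫ jφ := by
      rw [hjK, hjφ, ← Spec.map_comp, ← CommRingCat.ofHom_comp]
    rw [h]; exact big
  have hgen : IsSmoothProjective n (WittScheme.genericFibre 𝒴) :=
    { smoothOfRelativeDimension := inferInstance
      isProjectiveOver := isProjectiveOver_of_isPullback_proj emb hembg _ _ bigK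
      geometricallyIrreducible := by
        rw [hgen_hom]
        exact MorphismProperty.pullback_snd (P := @GeometricallyIrreducible) 𝒴.hom jK h𝒴irr }
  -- H. the isomorphism `𝒴_K ⊗_ι ℂ ≅ X`
  have e : (baseChangeHom ι).obj (WittScheme.genericFibre 𝒴) ≅ X :=
    Over.isoMk SqX.isoPullback.symm (by
      change SqX.isoPullback.inv ≫ X.hom = pullback.snd (WittScheme.genericFibre 𝒴).hom jι
      exact SqX.isoPullback_inv_snd)
  -- I. `𝒴 ↪ ℙᴹ_W` is closed (base change of `Y ↪ ℙᴹ_T`)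
  letI : Algebra T W := χ.toAlgebra
  letI := MvPolynomial.gradedAlgebra (σ := Fin (M + 1)) (R := W)
  obtain ⟨embW, hembW, hembWg⟩ : ∃ embW : pullback g jφ ⟶ Proj (homogeneousSubmodule (Fin (M + 1)) W),
      IsClosedImmersion embW ∧
        embW ≫ ProjBaseChangeRing.projToSpec (Fin (M + 1)) W = pullback.snd g jφ := by
    have h := exists_isClosedImmersion_pullback_proj W emb
    rw [hembg] at h
    exact h
  exact ⟨embW, hembW, hembWg, ⟨h𝒴S, h𝒴P, hsp, hgen⟩, ⟨e⟩⟩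


end Literature.AlgebraicGeometry.Motives

end
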